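import Literature.Geometry.Kaehler.ComplexTorusMixedHodgeRiemannTimorin
import HarnessLib

/-!
# Dinh–Nguyên's Theorems A, B, C on a complex torus in EVERY bidegree — mixed hard Lefschetz as an
# isomorphism `Λ^{p,q} ≅ Λ^{g-q,g-p}`, the mixed Lefschetz decomposition, and the indices of inertia of the
# mixed Hodge–Riemann form on `Λ^{p,q}` (the mixed Hodge index theorem), unconditionally

Layer `Literature/Geometry/Kaehler`, namespace `Literature.Geometry.Kaehler.ComplexTorus`; lane `lit-hodgefound`
(Track 2, HodgeConjecture), seat p16, generation 25 (row g25-#1). Sequel of the programme T1–T4 (T4b =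
`ComplexTorusMixedHodgeRiemannTimorin`: Timorin's theorem, i.e. mixed Hodge–Riemann and mixed hard Lefschetz
for constant forms of every bidegree on a complex torus). Everything here is PROVED: theorems only, no definition, no
named fact (net debt 0). The three hypotheses under which T2 (`ComplexTorusMixedLefschetzDecomposition`) and T4a
(`ComplexTorusMixedHodgeRiemannForm`) were written — mixed hard Lefschetz for the background, for the background
with its last form dropped, and with its last form repeated — are theorems since T4b; this file discharges them and
draws the consequences that the sources state or use, in every bidegree `(p, q)`:

* §1 **Theorem B** (Dinh–Nguyên Prop. 2.1 (a) / Theorem B for a torus; Cattani Thm. 1.3 "Mixed HLT … is an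
  isomorphism"): for positive real `(1,1)`-forms `θ_1, …, θ_r` on `E`, `dim_ℂ E = g = r + p + q`, the mixed
  Lefschetz operator `A ↦ (-θ_1)_ℂ ∧ ⋯ ∧ (-θ_r)_ℂ ∧ A` is a BIJECTION from the forms of type `(p, q)` onto the forms
  of type `(r+p, r+q) = (g-q, g-p)` (`mixedHardLefschetz_bijective_of_pos`, `mixedHardLefschetz_existsUnique_of_pos`);
* §2 **Theorem C** (Prop. 2.1 (c) / Theorem C for a torus; Cattani Thm. 2.2): for a positive background
  `θ_0, …, θ_n`, `g = n + p + q + 2`, `ω = (-θ_n)_ℂ`, every form of type `(p+1, q+1)` is uniquely `B + C ∧ ω` with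
  `B` mixed primitive of type `(p+1, q+1)` and `C` of type `(p, q)`; `dim_ℂ P^{p+1,q+1} = C(g,p+1) C(g,q+1) - C(g,p) C(g,q)`
  (so `C(g,p) C(g,q) ≤ C(g,p+1) C(g,q+1)` for `p + q + 2 ≤ g`); over `ℝ` the two summands are complementary
  (`exists_mem_mixedPrimitiveForms_add_wedge_eq_of_pos`, `mixedLefschetzDecomposition_unique_of_pos`,
  `finrank_mixedPrimitiveForms_inf_typeSubmodule_of_pos`, `isCompl_primitiveReal_lefschetzReal_of_pos`);
* §3 on a torus `X = E/Φ(ℤ^ι)`: the real mixed Hodge–Riemann form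
  `h_θ(A, B) = Re(ε(k,p,q) ∫_X (-θ_1)_ℂ ∧ ⋯ ∧ (-θ_n)_ℂ ∧ A ∧ B̄)` on `Λ^{p,q}` (T4a `hrFormPQ`,
  `ε(k,p,q) = (-1)^{k(k-1)/2} i^{p-q}`, `k = p + q`, `g = n + k`) is NON-DEGENERATE for every positive background
  (`hrFormPQ_nondegenerate_of_pos`), so `b⁺ + b⁻ = 2 C(g,p) C(g,q)`;
* §4 **the mixed Hodge index theorem in every bidegree**: the indices of inertia `(b⁺, b⁻)` of `h_θ` on `Λ^{p,q}` do
  not depend on the positive background (`sigPos_sigNeg_hrFormPQ_eq_of_pos`, Timorin's deformation argument now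
  unconditional), satisfy the recursion `b⁺(p+1,q+1) = 2 dim_ℂ P^{p+1,q+1} + b⁻(p,q)`, `b⁻(p+1,q+1) = b⁺(p,q)` along
  the `h`-orthogonal mixed Lefschetz decomposition — `h` POSITIVE DEFINITE on `P` (Prop. 2.1 (b)), the Lefschetz
  summand isometric to `h^{(p,q)}` of the background with `ω` repeated and the opposite sign `ε(k+2) = -ε(k)`
  (`sigPos_sigNeg_hrFormPQ_succ_succ_of_pos`) — with base `(b⁺, b⁻) = (2 C(g,p) C(g,q), 0)` in bidegrees `(p,0)`,
  `(0,q)`; hence the closed form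
  **`b⁺ = 2 Σ_{0 ≤ j ≤ min(p,q)} (-1)^j C(g,p-j) C(g,q-j)`, `b⁻ = 2 Σ_{0 ≤ j < min(p,q)} (-1)^j C(g,p-1-j) C(g,q-1-j)`**
  (`sigPos_sigNeg_hrFormPQ_of_pos`; signature `τ = 2 C(g,p) C(g,q) + 4 Σ_{j<min} (-1)^{j+1} C(g,p-1-j) C(g,q-1-j)`,
  both indices even; `(1,1)`: `(2(g²-1), 2)`; the empty background = the classical Hodge index count on
  `H^{p,q}(X)`, `p + q = g`, Voisin's Thm. 6.33 bidegree by bidegree);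
* §5 **the closure of the cone**: for a SEMI-positive background (`θ_j(i·,i·) = θ_j`, `θ_j(iv, v) ≥ 0`) the indices
  can only drop, `b^±(h_θ) ≤` the values above (lower semicontinuity of the indices, T1, and `θ + cη → θ` through
  positive backgrounds), and `h_θ` is non-degenerate iff both bounds are attained (Dinh–Nguyên's §4 "by continuity"
  argument for the boundary of the Hodge–Riemann cone, in every bidegree).

## Sources (held copies read; locators are arXiv PDF pages / chunks)

* T.-C. Dinh, V.-A. Nguyên, *The mixed Hodge–Riemann bilinear relations for compact Kähler manifolds*, GAFA 16
  (2006) 838–849 [DinhNguyen2006] (held `paper:arxiv-math_0501449`). p. 5 (chunk p0005): "**Proposition 2.1.** Let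
  `p, q` be integers such that `0 ≤ p, q ≤ p + q ≤ n` and `ω_1, …, ω_{n-p-q+1}` strictly positive forms of
  `Λ^{1,1}(ℂⁿ)`. Define the sesquilinear Hermitian symmetric form `Q(α, β) := i^{p-q} (-1)^{(n-p-q)(n-p-q-1)/2}
  ∗(α ∧ β̄ ∧ Ω)` […] `Ω := ω_1 ∧ ⋯ ∧ ω_{n-p-q}`. Define the mixed primitive subspace
  `P^{p,q}(ℂⁿ) := {α ∈ Λ^{p,q}(ℂⁿ) : α ∧ Ω ∧ ω_{n-p-q+1} = 0}`. Then (a) The operator of multiplication by `Ω` induces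
  an isomorphism between `Λ^{p,q}(ℂⁿ)` and `Λ^{n-q,n-p}(ℂⁿ)`. (b) `Q(·,·)` is positive definite on `P^{p,q}(ℂⁿ)`.
  (c) The space `Λ^{p,q}(ℂⁿ)` splits into the `Q`-orthogonal direct sum `Λ^{p,q}(ℂⁿ) = P^{p,q}(ℂⁿ) ⊕ ω_{n-p-q+1} ∧
  Λ^{p-1,q-1}(ℂⁿ)` […]. Proof. See Proposition 1, the Main Theorem and Corollary 2 in [Timorin]." — p. 3 (chunk
  p0003): "**Theorem 1.3 (Timorin's Theorem)** If `X` is a complex torus of dimension `n`, then `Q(·,·)` is positive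
  definite on `P^{p,q}(X)`" and Theorem A; p. 4 (chunk p0004): Theorems B ("the linear map
  `τ([α]) := [Ω] ∧ [α]` […] is an isomorphism") and C ("`H^{p,q}(X) = P^{p,q}(X) ⊕ [ω_{n-p-q+1}] ∧ H^{p-1,q-1}(X)`");
  p. 9 (chunk p0009) §4, Prop. 4.1 and its proof ("By continuity, `Q(·,·)` is positive semi-definite on `P^{1,1}(X)`
  […] the Poincaré duality implies that `c ∧ [Ω] = 0`"), Remarks 4.2. On a torus `H^{p,q}(X)` is the space of
  constant forms `Λ^{p,q}`, so Theorems A–C for `X` a torus ARE Prop. 2.1; the tree integrates `∗` against the volume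
  (`∫_X`, `torusIntegral`) and carries Voisin's sign `ε(k,p,q)` with `Ω` in front (T4a).
* V. A. Timorin, *Mixed Hodge–Riemann bilinear relations in a linear context*, Funct. Anal. Appl. 32 (1998) 268–272
  [Timorin1998] — Proposition 1, Main Theorem, Corollary 2 (not held; cited through Dinh–Nguyên loc. cit. and
  Cattani p. 3: "Timorin proved the above mixed theorems in the linear algebraic context, i.e. the cohomology algebra
  of a torus").
* E. Cattani, *Mixed Lefschetz theorems and Hodge–Riemann bilinear relations*, IMRN 2008 [Cattani2008MixedLefschetz]
  (held `paper:arxiv-0707.1352`), p. 3 (chunk p0003) Thm. 1.3 (Mixed HLT: "`L_{ω_1} ⋯ L_{ω_m} : H^{k-m}(X, ℂ) →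
  H^{k+m}(X, ℂ)` is an isomorphism"), Thm. 1.4 (Mixed HRR); p. 5 (chunk p0005) Def. 2.1 / Thm. 2.2
  ("`V_m = (ker(N^{m+1}) ∩ V_m) ⊕ N V_{m+2}`").
* C. Voisin, *Hodge Theory and Complex Algebraic Geometry I* (2002) [VoisinHodgeI2002], §6.3.2 Thm. 6.32 (the sign
  `(-1)^{k(k-1)/2} i^{p-q}` and definiteness on primitive parts) and Thm. 6.33 with its proof (the Hodge index theorem:
  the signature computed by summing definite pieces of alternating sign over the Lefschetz decomposition), §6.2.3.
* J. Gregory, *Quadratic Form Theory and Differential Equations* (1980) [Gregory1980QuadraticForms], Ch. 2 §2.2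
  Thm. 12 / Thm. 14 (Sylvester), §2.3 Thm. 5, Thm. 6 (5), Cor. 7, Cor. 8 (semicontinuity and local constancy of the
  indices; chunks p0077–p0087) — as used in T1.
* H. Lange, *Abelian Varieties over the Complex Numbers* (2023) [Lange2023AbelianVarietiesComplex], §1.1.5
  Prop. 1.1.23 (`dim Λ^{p,q} = C(g,p) C(g,q)`), §1.1.3 Cor. 1.1.19; D. Huybrechts, *Complex Geometry* (2005)
  [Huybrechts2005], §3.1 Examples 3.1.9 ii) (every torus is Kähler: positive backgrounds of every length exist).

Not claimed here: Dinh–Nguyên's Prop. 2.2 (the norm estimate) and their Theorems A–C for general compact Kähler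
manifolds (the `dd^c`-method of §3); Timorin's general polytope version.
-/

noncomputable section

set_option maxSynthPendingDepth 3

open scoped ComplexConjugate ComplexOrder
open Complex Function Module Finset
open Literature.LinearAlgebra.Alternating
open Literature.Analysis.Complex (oneForm₀ IsOfTypeAt typeSubmodule isOfTypeAt_of_mem_typeSubmodule finrank_typeSubmodule)

namespace Literature.Geometry.Kaehler

namespace ComplexTorus

universe u

open Literature.LinearAlgebra.QuadraticForm

/-! ## §1 Theorem B: mixed hard Lefschetz is an ISOMORPHISM `Λ^{p,q} ⥲ Λ^{r+p, r+q} = Λ^{g-q, g-p}` -/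

section TheoremB

variable {E : Type u} [NormedAddCommGroup E] [NormedSpace ℂ E] [FiniteDimensional ℂ E]

/-- **`dim Λ^{r+p, r+q} = dim Λ^{p,q} = C(g,p) C(g,q)`** on a space of dimension `g = r + p + q`
(`Λ^{r+p, r+q} = Λ^{g-q, g-p}` and `C(g, g-q) = C(g, q)`). [cite: Lange2023AbelianVarietiesComplex, §1.1.5 Prop. 1.1.23]
[cite: DinhNguyen2006, §2 Prop. 2.1 (a) (arXiv PDF p. 5)] -/
theorem finrank_typeSubmodule_add_add_eq {g r k p q K : ℕ} (hg : finrank ℂ E = g) (hpq : p + q = k)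
    (hrk : r + k = g) (hK : (r + p) + (r + q) = K) :
    finrank ℂ (typeSubmodule E K (r + p) (r + q)) = finrank ℂ (typeSubmodule E k p q) := by
  rw [finrank_typeSubmodule (k := K) (p := r + p) (q := r + q) hK, finrank_typeSubmodule hpq, hg,
    Nat.choose_symm_of_eq_add (show g = (r + p) + q by omega),
    Nat.choose_symm_of_eq_add (show g = (r + q) + p by omega), mul_comm]

/-- **Theorem B on a complex torus (mixed hard Lefschetz as a BIJECTION), every bidegree**: for positive real
`(1,1)`-forms `θ_1, …, θ_r` on `E`, `dim_ℂ E = r + p + q`, the mixed Lefschetz operator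
`L_Θ : A ↦ (-θ_1)_ℂ ∧ ⋯ ∧ (-θ_r)_ℂ ∧ A` restricted to the forms of type `(p, q)` is a bijection onto the forms of
type `(r+p, r+q)` ("the operator of multiplication by `Ω` induces an isomorphism between `Λ^{p,q}(ℂⁿ)` and
`Λ^{n-q,n-p}(ℂⁿ)`", Prop. 2.1 (a); Theorem B for `X` a torus): injective by Timorin's theorem (T4b
`mixedHardLefschetz_of_pos_length`) and the two spaces have the same dimension.
[cite: DinhNguyen2006, §2 Prop. 2.1 (a) and §1 Theorem B (arXiv PDF pp. 4–5)] [cite: Timorin1998, Main Theorem]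
[cite: Cattani2008MixedLefschetz, Thm. 1.3] -/
theorem mixedHardLefschetz_bijective_of_pos {r k p q K : ℕ} (hg : finrank ℂ E = r + k) (hpq : p + q = k)
    (hK : 2 * r + k = K) {s : Fin r → E [⋀^Fin 2]→L[ℝ] ℝ} (hs : s ∈ positiveTuples E r) :
    Function.Bijective ((mixedLefschetz (fun j ↦ ofRealForm (-(s j))) hK).restrict
      (p := typeSubmodule E k p q) (q := typeSubmodule E K (r + p) (r + q))
      (fun _ hA ↦ mixedLefschetz_mem_typeSubmodule (isOfTypeAt_of_mem_positiveTuples hs) hK hpq hA)) := by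
  set L := (mixedLefschetz (fun j ↦ ofRealForm (-(s j))) hK).restrict
      (p := typeSubmodule E k p q) (q := typeSubmodule E K (r + p) (r + q))
      (fun _ hA ↦ mixedLefschetz_mem_typeSubmodule (isOfTypeAt_of_mem_positiveTuples hs) hK hpq hA) with hL
  have hinj : Function.Injective L := by
    rw [injective_iff_map_eq_zero]
    intro A hA
    have h0 : mixedLefschetz (fun j ↦ ofRealForm (-(s j))) hK (A : E [⋀^Fin k]→L[ℝ] ℂ) = 0 :=
      congrArg Subtype.val hA
    rw [mixedLefschetz_eq_zero_iff] at h0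
    exact Subtype.ext (mixedHardLefschetz_of_pos_length hg hpq hs A.2 h0)
  have hdim : finrank ℂ (typeSubmodule E k p q) = finrank ℂ (typeSubmodule E K (r + p) (r + q)) :=
    (finrank_typeSubmodule_add_add_eq hg hpq rfl (by omega)).symm
  exact ⟨hinj, (LinearMap.injective_iff_surjective_of_finrank_eq_finrank hdim).1 hinj⟩

/-- **Theorem B, surjectivity in the language of forms**: every form `B` of type `(r+p, r+q)` is
`(-θ_1)_ℂ ∧ ⋯ ∧ (-θ_r)_ℂ ∧ A` for a unique `A` of type `(p, q)` (`dim_ℂ E = r + p + q`, `θ_j` positive).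
[cite: DinhNguyen2006, §2 Prop. 2.1 (a) and §1 Theorem B (arXiv PDF pp. 4–5)] [cite: Timorin1998, Main Theorem] -/
theorem mixedHardLefschetz_existsUnique_of_pos {r k p q : ℕ} (hg : finrank ℂ E = r + k) (hpq : p + q = k)
    {s : Fin r → E [⋀^Fin 2]→L[ℝ] ℝ} (hs : s ∈ positiveTuples E r)
    {B : E [⋀^Fin (2 * r + k)]→L[ℝ] ℂ} (hB : B ∈ typeSubmodule E (2 * r + k) (r + p) (r + q)) :
    ∃! A : E [⋀^Fin k]→L[ℝ] ℂ, A ∈ typeSubmodule E k p q ∧ (wedgeFamily r fun j ↦ ofRealForm (-(s j))).wedge A = B := by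
  obtain ⟨hinj, hsurj⟩ := mixedHardLefschetz_bijective_of_pos (p := p) (q := q) hg hpq rfl hs
  obtain ⟨A, hA⟩ := hsurj ⟨B, hB⟩
  have hA' : (wedgeFamily r fun j ↦ ofRealForm (-(s j))).wedge (A : E [⋀^Fin k]→L[ℝ] ℂ) = B := by
    have h : mixedLefschetz (fun j ↦ ofRealForm (-(s j))) rfl (A : E [⋀^Fin k]→L[ℝ] ℂ) = B :=
      congrArg Subtype.val hA
    rwa [mixedLefschetz_apply, domDomCongr_finCongr_self] at h
  refine ⟨A, ⟨A.2, hA'⟩, fun A' hA'' ↦ ?_⟩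
  have h1 : (mixedLefschetz (fun j ↦ ofRealForm (-(s j))) rfl).restrict
      (p := typeSubmodule E k p q) (q := typeSubmodule E (2 * r + k) (r + p) (r + q))
      (fun _ hA ↦ mixedLefschetz_mem_typeSubmodule (isOfTypeAt_of_mem_positiveTuples hs) rfl hpq hA) ⟨A', hA''.1⟩ =
      ⟨B, hB⟩ := by
    apply Subtype.ext
    show mixedLefschetz (fun j ↦ ofRealForm (-(s j))) rfl A' = B
    rw [mixedLefschetz_apply, domDomCongr_finCongr_self]
    exact hA''.2
  exact congrArg Subtype.val (hinj (h1.trans hA.symm))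

end TheoremB

/-! ## §2 Theorem C: the mixed Lefschetz decomposition `Λ^{p+1,q+1} = P^{p+1,q+1} ⊕ ω ∧ Λ^{p,q}` for every positive
background, and the dimension of the mixed primitive space -/

section TheoremC

variable {E : Type u} [NormedAddCommGroup E] [NormedSpace ℂ E] [FiniteDimensional ℂ E]

/-- Mixed hard Lefschetz for the background `(θ_0, …, θ_n, θ_n)` (last form repeated) on `Λ^{p,q}`,
`dim_ℂ E = n + p + q + 2` — the hypothesis `hHL` / `hHL₂` of T2 and T4a, now a theorem.
[cite: DinhNguyen2006, §2 Prop. 2.1 (a) (arXiv PDF p. 5)] [cite: Timorin1998, Main Theorem] -/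
theorem mixedHardLefschetz_snoc_of_pos {g n m p q : ℕ} (hg : finrank ℂ E = g) (hpq : p + q = m)
    (hnk : n + (m + 2) = g) {t : Fin (n + 1) → E [⋀^Fin 2]→L[ℝ] ℝ} (ht : t ∈ positiveTuples E (n + 1))
    {C : E [⋀^Fin m]→L[ℝ] ℂ} (hC : C ∈ typeSubmodule E m p q)
    (h0 : (wedgeFamily (n + 2) (Fin.snoc (α := fun _ ↦ E [⋀^Fin 2]→L[ℝ] ℂ) (fun j ↦ ofRealForm (-(t j)))
      (ofRealForm (-(t (Fin.last n)))))).wedge C = 0) : C = 0 := by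
  rw [← ofRealForm_neg_snoc] at h0
  exact mixedHardLefschetz_of_pos_length (by omega) hpq (snoc_mem_positiveTuples ht) hC h0

/-- Mixed hard Lefschetz for the background `(θ_0, …, θ_{n-1})` (last form dropped) on `Λ^{p,q}`,
`dim_ℂ E = n + p + q` — the hypothesis `hHL₁` of T4a, now a theorem. [cite: DinhNguyen2006, §2 Prop. 2.1 (a) (arXiv PDF p. 5)]
[cite: Timorin1998, Main Theorem] -/
theorem mixedHardLefschetz_castSucc_of_pos {g n k p q : ℕ} (hg : finrank ℂ E = g) (hpq : p + q = k)
    (hnk : n + k = g) {t : Fin (n + 1) → E [⋀^Fin 2]→L[ℝ] ℝ} (ht : t ∈ positiveTuples E (n + 1))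
    {A : E [⋀^Fin k]→L[ℝ] ℂ} (hA : A ∈ typeSubmodule E k p q)
    (h0 : (wedgeFamily n fun j ↦ ofRealForm (-(t (Fin.castSucc j)))).wedge A = 0) : A = 0 :=
  mixedHardLefschetz_of_pos_length (by omega) hpq (castSucc_mem_positiveTuples ht) hA h0

/-- **Theorem C on a complex torus (the mixed Lefschetz decomposition), every bidegree — existence**: for
positive real `(1,1)`-forms `θ_0, …, θ_n` on `E` with `dim_ℂ E = n + p + q + 2`, every form `A` of type
`(p+1, q+1)` is `B + C ∧ ω` with `ω = (-θ_n)_ℂ`, `B` of type `(p+1, q+1)` and MIXED PRIMITIVE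
(`(-θ_0)_ℂ ∧ ⋯ ∧ (-θ_n)_ℂ ∧ B = 0`) and `C` of type `(p, q)` ("`Λ^{p,q}(ℂⁿ) = P^{p,q}(ℂⁿ) ⊕ ω_{n-p-q+1} ∧ Λ^{p-1,q-1}(ℂⁿ)`",
Prop. 2.1 (c); T2 `exists_mem_mixedPrimitiveForms_add_wedge_eq` with its mixed hard Lefschetz hypothesis discharged by
Timorin's theorem). [cite: DinhNguyen2006, §2 Prop. 2.1 (c) and §1 Theorem C (arXiv PDF pp. 4–5)]
[cite: Cattani2008MixedLefschetz, Thm. 2.2] [cite: Timorin1998, Corollary 2] -/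
theorem exists_mem_mixedPrimitiveForms_add_wedge_eq_of_pos {g n m p q : ℕ} (hg : finrank ℂ E = g) (hpq : p + q = m)
    (hnk : n + (m + 2) = g) {t : Fin (n + 1) → E [⋀^Fin 2]→L[ℝ] ℝ} (ht : t ∈ positiveTuples E (n + 1))
    {A : E [⋀^Fin (m + 2)]→L[ℝ] ℂ} (hA : A ∈ typeSubmodule E (m + 2) (p + 1) (q + 1)) :
    ∃ B ∈ mixedPrimitiveForms (fun j ↦ ofRealForm (-(t j))) (m + 2) ⊓ typeSubmodule E (m + 2) (p + 1) (q + 1),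
      ∃ C ∈ typeSubmodule E m p q, A = B + C.wedge (ofRealForm (-(t (Fin.last n)))) :=
  exists_mem_mixedPrimitiveForms_add_wedge_eq hg hpq hnk (isOfTypeAt_of_mem_positiveTuples ht)
    (fun _ hC h0 ↦ mixedHardLefschetz_snoc_of_pos hg hpq hnk ht hC h0) hA

/-- **Theorem C — uniqueness**: with `θ_j`, `ω = (-θ_n)_ℂ` as above, `B + C ∧ ω = B' + C' ∧ ω` with `B, B'` mixed
primitive and `C, C'` of type `(p, q)` forces `B = B'` and `C = C'` (wedge with `(-θ_0)_ℂ ∧ ⋯ ∧ (-θ_n)_ℂ` and use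
mixed hard Lefschetz for the background with `ω` repeated). [cite: DinhNguyen2006, §2 Prop. 2.1 (c) (arXiv PDF p. 5)]
[cite: Cattani2008MixedLefschetz, Thm. 2.2] -/
theorem mixedLefschetzDecomposition_unique_of_pos {g n m p q : ℕ} (hg : finrank ℂ E = g) (hpq : p + q = m)
    (hnk : n + (m + 2) = g) {t : Fin (n + 1) → E [⋀^Fin 2]→L[ℝ] ℝ} (ht : t ∈ positiveTuples E (n + 1))
    {B B' : E [⋀^Fin (m + 2)]→L[ℝ] ℂ} (hB : B ∈ mixedPrimitiveForms (fun j ↦ ofRealForm (-(t j))) (m + 2))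
    (hB' : B' ∈ mixedPrimitiveForms (fun j ↦ ofRealForm (-(t j))) (m + 2))
    {C C' : E [⋀^Fin m]→L[ℝ] ℂ} (hC : C ∈ typeSubmodule E m p q) (hC' : C' ∈ typeSubmodule E m p q)
    (h : B + C.wedge (ofRealForm (-(t (Fin.last n)))) = B' + C'.wedge (ofRealForm (-(t (Fin.last n))))) :
    B = B' ∧ C = C' := by
  have h0 : (B - B') + (C - C').wedge (ofRealForm (-(t (Fin.last n)))) = 0 := by
    rw [← wedgeRight_apply, map_sub, wedgeRight_apply, wedgeRight_apply, sub_add_sub_comm, h, sub_self]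
  have h1 := eq_zero_of_mem_mixedPrimitiveForms_of_add_wedge_eq_zero (fun j ↦ ofRealForm (-(t j)))
    (fun _ hC h0 ↦ mixedHardLefschetz_snoc_of_pos hg hpq hnk ht hC h0) (Submodule.sub_mem _ hB hB')
    (Submodule.sub_mem _ hC hC') h0
  exact ⟨sub_eq_zero.1 h1.2, sub_eq_zero.1 h1.1⟩

/-- **The dimension of the mixed primitive space, every bidegree (unconditional)**:
`dim_ℂ (P_Θ ∩ Λ^{p+1,q+1}) = C(g,p+1) C(g,q+1) - C(g,p) C(g,q)` for every positive background
`Θ = ((-θ_0)_ℂ, …, (-θ_n)_ℂ)`, `g = dim_ℂ E = n + p + q + 2` — independent of the background.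
[cite: DinhNguyen2006, §2 Prop. 2.1 (c) (arXiv PDF p. 5)] [cite: Lange2023AbelianVarietiesComplex, §1.1.5 Prop. 1.1.23]
[cite: VoisinHodgeI2002, §6.2.3 Cor. 6.25 / Rem. 6.26] -/
theorem finrank_mixedPrimitiveForms_inf_typeSubmodule_of_pos {g n m p q : ℕ} (hg : finrank ℂ E = g) (hpq : p + q = m)
    (hnk : n + (m + 2) = g) {t : Fin (n + 1) → E [⋀^Fin 2]→L[ℝ] ℝ} (ht : t ∈ positiveTuples E (n + 1)) :
    finrank ℂ ↥(mixedPrimitiveForms (fun j ↦ ofRealForm (-(t j))) (m + 2) ⊓ typeSubmodule E (m + 2) (p + 1) (q + 1)) =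
      g.choose (p + 1) * g.choose (q + 1) - g.choose p * g.choose q :=
  finrank_mixedPrimitiveForms_inf_typeSubmodule hg hpq hnk (isOfTypeAt_of_mem_positiveTuples ht)
    (fun _ hC h0 ↦ mixedHardLefschetz_snoc_of_pos hg hpq hnk ht hC h0)

/-- The same dimension count without truncated subtraction: `dim_ℂ (P_Θ ∩ Λ^{p+1,q+1}) + C(g,p) C(g,q) =
C(g,p+1) C(g,q+1)` (in particular `C(g,p) C(g,q) ≤ C(g,p+1) C(g,q+1)` for `p + q + 2 ≤ g`).
[cite: DinhNguyen2006, §2 Prop. 2.1 (c) (arXiv PDF p. 5)] [cite: Lange2023AbelianVarietiesComplex, §1.1.5 Prop. 1.1.23] -/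
theorem finrank_mixedPrimitiveForms_inf_typeSubmodule_add_of_pos {g n m p q : ℕ} (hg : finrank ℂ E = g)
    (hpq : p + q = m) (hnk : n + (m + 2) = g) {t : Fin (n + 1) → E [⋀^Fin 2]→L[ℝ] ℝ}
    (ht : t ∈ positiveTuples E (n + 1)) :
    finrank ℂ ↥(mixedPrimitiveForms (fun j ↦ ofRealForm (-(t j))) (m + 2) ⊓ typeSubmodule E (m + 2) (p + 1) (q + 1)) +
        g.choose p * g.choose q = g.choose (p + 1) * g.choose (q + 1) := by
  have h := finrank_mixedPrimitiveForms_inf_typeSubmodule_add hg hpq hnk (isOfTypeAt_of_mem_positiveTuples ht)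
    (fun _ hC h0 ↦ mixedHardLefschetz_snoc_of_pos hg hpq hnk ht hC h0)
  rwa [finrank_typeSubmodule hpq, finrank_typeSubmodule (k := m + 2) (p := p + 1) (q := q + 1) (by omega), hg] at h

/-- Hence **`C(g,p) C(g,q) ≤ C(g,p+1) C(g,q+1)` whenever `p + q + 2 ≤ g`** (the Hodge numbers of a torus increase
towards the middle along the Lefschetz direction) — a by-product of mixed hard Lefschetz.
[cite: Lange2023AbelianVarietiesComplex, §1.1.5 Prop. 1.1.23] [cite: VoisinHodgeI2002, §6.2.3 Cor. 6.25] -/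
theorem choose_mul_choose_le_choose_succ_mul_choose_succ {g n m p q : ℕ} (hg : finrank ℂ E = g) (hpq : p + q = m)
    (hnk : n + (m + 2) = g) {t : Fin (n + 1) → E [⋀^Fin 2]→L[ℝ] ℝ} (ht : t ∈ positiveTuples E (n + 1)) :
    g.choose p * g.choose q ≤ g.choose (p + 1) * g.choose (q + 1) := by
  have h := finrank_mixedPrimitiveForms_inf_typeSubmodule_add_of_pos hg hpq hnk ht
  omega

/-- **Theorem C over `ℝ`**: `Λ^{p+1,q+1} = (P_Θ ∩ Λ^{p+1,q+1}) ⊕ ω ∧ Λ^{p,q}` as real vector spaces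
(`primitiveReal` and `lefschetzReal` of T4a are complementary), for every positive background.
[cite: DinhNguyen2006, §2 Prop. 2.1 (c) (arXiv PDF p. 5)] [cite: Cattani2008MixedLefschetz, Thm. 2.2] -/
theorem isCompl_primitiveReal_lefschetzReal_of_pos {g n m p q : ℕ} (hg : finrank ℂ E = g) (hpq : p + q = m)
    (hnk : n + (m + 2) = g) {t : Fin (n + 1) → E [⋀^Fin 2]→L[ℝ] ℝ} (ht : t ∈ positiveTuples E (n + 1)) :
    IsCompl (primitiveReal (fun j ↦ ofRealForm (-(t j))) (m + 2) (p + 1) (q + 1))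
      (lefschetzReal (ofRealForm (-(t (Fin.last n)))) m p q) :=
  isCompl_primitiveReal_lefschetzReal hg hpq hnk (isOfTypeAt_of_mem_positiveTuples ht)
    (fun _ hC h0 ↦ mixedHardLefschetz_snoc_of_pos hg hpq hnk ht hC h0)

/-- **`dim_ℝ (P_Θ ∩ Λ^{p+1,q+1}) = 2 (C(g,p+1) C(g,q+1) - C(g,p) C(g,q))`** for every positive background.
[cite: DinhNguyen2006, §2 Prop. 2.1 (c) (arXiv PDF p. 5)] [cite: VoisinHodgeI2002, §6.2.3 Cor. 6.25 / Rem. 6.26] -/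
theorem finrank_primitiveReal_succ_succ_of_pos {g n m p q : ℕ} (hg : finrank ℂ E = g) (hpq : p + q = m)
    (hnk : n + (m + 2) = g) {t : Fin (n + 1) → E [⋀^Fin 2]→L[ℝ] ℝ} (ht : t ∈ positiveTuples E (n + 1)) :
    finrank ℝ ↥(primitiveReal (fun j ↦ ofRealForm (-(t j))) (m + 2) (p + 1) (q + 1)) =
      2 * (g.choose (p + 1) * g.choose (q + 1) - g.choose p * g.choose q) :=
  finrank_primitiveReal_succ_succ hg hpq hnk (isOfTypeAt_of_mem_positiveTuples ht)
    (fun _ hC h0 ↦ mixedHardLefschetz_snoc_of_pos hg hpq hnk ht hC h0)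

end TheoremC

/-! ## §3 The mixed Hodge–Riemann form on `Λ^{p,q}` is non-degenerate for every positive background -/

section Nondegenerate

variable {ι : Type*} [Fintype ι] [DecidableEq ι] {E : Type u} [NormedAddCommGroup E] [NormedSpace ℂ E]
  (Φ : (ι → ℝ) ≃L[ℝ] E)

/-- **Non-degeneracy, every bidegree (unconditional)**: on a complex torus `X = E/Φ(ℤ^ι)` of dimension
`g = n + p + q`, for positive real `(1,1)`-forms `θ_1, …, θ_n`, the real mixed Hodge–Riemann form
`h(A, B) = Re(ε(k,p,q) ∫_X (-θ_1)_ℂ ∧ ⋯ ∧ (-θ_n)_ℂ ∧ A ∧ B̄)` on `Λ^{p,q}` is non-degenerate (mixed hard Lefschetz +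
Poincaré duality, T4a `hrFormPQ_nondegenerate`; "`Q` non-degenerate", Cattani Def. 2.1 / Thm. 2.2).
[cite: DinhNguyen2006, §2 Prop. 2.1 (a) and §4 Remarks 4.2 (arXiv PDF pp. 5, 9)] [cite: Cattani2008MixedLefschetz, §2 Def. 2.1 and Thm. 2.2]
[cite: Timorin1998, Main Theorem] -/
theorem hrFormPQ_nondegenerate_of_pos {g n k p q : ℕ} (e : Fin (2 * g) ≃ ι) (hnk : n + k = g) (hpq : p + q = k)
    (h2 : 2 * n + (k + k) = 2 * g) {s : Fin n → E [⋀^Fin 2]→L[ℝ] ℝ} (hs : s ∈ positiveTuples E n) :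
    (hrFormPQ Φ e (hrSign k p q) (wedgeFamily n fun j ↦ ofRealForm (-(s j))) h2 p q).Nondegenerate := by
  haveI := finiteDimensional_complex Φ
  have hg : finrank ℂ E = g := finrank_eq_of_finTwoMulEquiv Φ e
  exact hrFormPQ_nondegenerate (isOfTypeAt_of_mem_positiveTuples hs) (conjForm_ofRealForm_neg_family s) hnk hpq h2
    (conj_hrSign hpq) (hrSign_ne_zero k p q)
    (fun _ hA h0 ↦ mixedHardLefschetz_of_pos_length (by omega) hpq hs hA h0)

/-- Hence the quadratic form `A ↦ h(A, A)` on `Λ^{p,q}` has trivial radical, for every positive background.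
[cite: DinhNguyen2006, §2 Prop. 2.1 (a) (arXiv PDF p. 5)] [cite: Gregory1980QuadraticForms, Ch. 2 §2.3 Cor. 8 (chunk p0087)] -/
theorem radical_hrFormPQ_eq_bot_of_pos {g n k p q : ℕ} (e : Fin (2 * g) ≃ ι) (hnk : n + k = g) (hpq : p + q = k)
    (h2 : 2 * n + (k + k) = 2 * g) {s : Fin n → E [⋀^Fin 2]→L[ℝ] ℝ} (hs : s ∈ positiveTuples E n) :
    (hrFormPQ Φ e (hrSign k p q) (wedgeFamily n fun j ↦ ofRealForm (-(s j))) h2 p q).toQuadraticMap.radical = ⊥ := by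
  haveI := finiteDimensional_complex Φ
  have hg : finrank ℂ E = g := finrank_eq_of_finTwoMulEquiv Φ e
  exact radical_hrFormPQ_eq_bot (isOfTypeAt_of_mem_positiveTuples hs) (conjForm_ofRealForm_neg_family s) hnk hpq h2
    (conj_hrSign hpq) (hrSign_ne_zero k p q)
    (fun _ hA h0 ↦ mixedHardLefschetz_of_pos_length (by omega) hpq hs hA h0)

/-- **`b⁺ + b⁻ = dim_ℝ Λ^{p,q} = 2 C(g,p) C(g,q)`** for the mixed Hodge–Riemann form of every positive background
(non-degenerate: no null directions). [cite: DinhNguyen2006, §2 Prop. 2.1 (a) (arXiv PDF p. 5)]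
[cite: Gregory1980QuadraticForms, Ch. 2 §2.2 Thm. 14 (chunk p0078)] [cite: Lange2023AbelianVarietiesComplex, §1.1.5 Prop. 1.1.23] -/
theorem sigPos_add_sigNeg_hrFormPQ_of_pos {g n k p q : ℕ} (e : Fin (2 * g) ≃ ι) (hnk : n + k = g) (hpq : p + q = k)
    (h2 : 2 * n + (k + k) = 2 * g) {s : Fin n → E [⋀^Fin 2]→L[ℝ] ℝ} (hs : s ∈ positiveTuples E n) :
    sigPos (hrFormPQ Φ e (hrSign k p q) (wedgeFamily n fun j ↦ ofRealForm (-(s j))) h2 p q).toQuadraticMap +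
        sigNeg (hrFormPQ Φ e (hrSign k p q) (wedgeFamily n fun j ↦ ofRealForm (-(s j))) h2 p q).toQuadraticMap =
      2 * (g.choose p * g.choose q) := by
  haveI := finiteDimensional_complex Φ
  haveI : FiniteDimensional ℝ (E [⋀^Fin k]→L[ℝ] ℂ) := finiteDimensional_real_complexForms
  have hg : finrank ℂ E = g := finrank_eq_of_finTwoMulEquiv Φ e
  rw [sigPos_add_sigNeg_eq_finrank_of_radical_eq_bot (radical_hrFormPQ_eq_bot_of_pos Φ e hnk hpq h2 hs),
    finrank_typeSubmodule_real hg hpq]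

end Nondegenerate

/-! ## §4 The indices of inertia of the mixed Hodge–Riemann form on `Λ^{p,q}` — the mixed Hodge index theorem in
every bidegree -/

section Signature

variable {ι : Type*} [Fintype ι] [DecidableEq ι] {E : Type u} [NormedAddCommGroup E] [NormedSpace ℂ E]
  (Φ : (ι → ℝ) ≃L[ℝ] E)

omit [DecidableEq ι] in
include Φ in
/-- **A positive tuple extends to a longer one** (append any positive `(1,1)`-form, e.g. the flat Kähler form of
the torus `E/Φ(ℤ^ι)`, `exists_pos_typeOneOne`). [cite: Huybrechts2005, §3.1 Examples 3.1.9 ii)]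
[cite: DinhNguyen2006, §2 Prop. 2.1 (arXiv PDF p. 5)] -/
theorem exists_mem_positiveTuples_castSucc_eq {n : ℕ} {s : Fin n → E [⋀^Fin 2]→L[ℝ] ℝ}
    (hs : s ∈ positiveTuples E n) :
    ∃ t ∈ positiveTuples E (n + 1), (fun j ↦ t (Fin.castSucc j)) = s := by
  obtain ⟨η, h11, hpos⟩ := exists_pos_typeOneOne Φ
  refine ⟨Fin.snoc (α := fun _ ↦ E [⋀^Fin 2]→L[ℝ] ℝ) s η, fun j ↦ ?_, funext fun j ↦ ?_⟩
  · refine Fin.lastCases ?_ (fun i ↦ ?_) j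
    · simp only [Fin.snoc_last]; exact ⟨h11, hpos⟩
    · simp only [Fin.snoc_castSucc]; exact hs i
  · simp only [Fin.snoc_castSucc]

omit [DecidableEq ι] in
include Φ in
/-- **Positive backgrounds of every length exist** on a complex torus (constant tuples of the flat Kähler form).
[cite: Huybrechts2005, §3.1 Examples 3.1.9 ii)] [cite: DinhNguyen2006, §2 Prop. 2.1 (arXiv PDF p. 5)] -/
theorem positiveTuples_nonempty (n : ℕ) : (positiveTuples E n).Nonempty := by
  obtain ⟨η, h11, hpos⟩ := exists_pos_typeOneOne Φ
  exact ⟨fun _ ↦ η, const_mem_positiveTuples h11 hpos n⟩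

/-- A positive definite real quadratic form has negative index `0` (`b⁺ + b⁻ + dim rad = dim V` and
`b⁺ = dim V`). [cite: Gregory1980QuadraticForms, Ch. 2 §2.2 Thm. 12 (a) and Thm. 14 (chunks p0077–p0078)] -/
private theorem sigNeg_eq_zero_of_posDef' {V : Type*} [AddCommGroup V] [Module ℝ V] [FiniteDimensional ℝ V]
    {Q : QuadraticForm ℝ V} (h : Q.PosDef) : sigNeg Q = 0 := by
  have h1 := QuadraticForm.sigPos_add_sigNeg_add_radical (Q := Q)
  have h2 := sigPos_eq_finrank_of_posDef h
  omega

/-- **The indices of inertia do not depend on the positive background (unconditional)**: for positive real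
`(1,1)`-forms `θ = (θ_1, …, θ_n)` on the torus `X` of dimension `n + p + q`, `b⁺` and `b⁻` of
`h_θ = Re(ε(k,p,q) ∫_X (-θ_1)_ℂ ∧ ⋯ ∧ (-θ_n)_ℂ ∧ A ∧ B̄)` on `Λ^{p,q}` are the same for all `θ` — Timorin's
deformation argument (T1: a continuous non-degenerate family over the CONVEX cone of positive backgrounds), the
non-degeneracy being a theorem by §3. [cite: Timorin1998, Main Theorem] [cite: DinhNguyen2006, §2 Prop. 2.1 (a), (b) (arXiv PDF p. 5)]
[cite: Gregory1980QuadraticForms, Ch. 2 §2.3 Cor. 8 (chunk p0087)] -/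
theorem sigPos_sigNeg_hrFormPQ_eq_of_pos {g n k p q : ℕ} (e : Fin (2 * g) ≃ ι) (hnk : n + k = g)
    (hpq : p + q = k) (h2 : 2 * n + (k + k) = 2 * g) {s t : Fin n → E [⋀^Fin 2]→L[ℝ] ℝ}
    (hs : s ∈ positiveTuples E n) (ht : t ∈ positiveTuples E n) :
    sigPos (hrFormPQ Φ e (hrSign k p q) (wedgeFamily n fun j ↦ ofRealForm (-(s j))) h2 p q).toQuadraticMap =
        sigPos (hrFormPQ Φ e (hrSign k p q) (wedgeFamily n fun j ↦ ofRealForm (-(t j))) h2 p q).toQuadraticMap ∧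
      sigNeg (hrFormPQ Φ e (hrSign k p q) (wedgeFamily n fun j ↦ ofRealForm (-(s j))) h2 p q).toQuadraticMap =
        sigNeg (hrFormPQ Φ e (hrSign k p q) (wedgeFamily n fun j ↦ ofRealForm (-(t j))) h2 p q).toQuadraticMap := by
  haveI := finiteDimensional_complex Φ
  have hg : finrank ℂ E = g := finrank_eq_of_finTwoMulEquiv Φ e
  exact sigPos_sigNeg_hrFormPQ_eq_of_mem_positiveTuples Φ e hnk hpq h2
    (fun _ hr _ hA h0 ↦ mixedHardLefschetz_of_pos_length (by omega) hpq hr hA h0) hs ht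

/-- **Base of the recursion — bidegrees `(p, 0)` and `(0, q)`**: there every form is mixed primitive, the form
`h_θ` is positive definite on `Λ^{p,q}` (Dinh–Nguyên Prop. 2.1 (b); T4b), so `(b⁺, b⁻) = (2 C(g,p) C(g,q), 0)` —
real dimension `2 dim_ℂ Λ^{p,q}`. [cite: DinhNguyen2006, §2 Prop. 2.1 (b) (arXiv PDF p. 5)] [cite: Timorin1998, Main Theorem]
[cite: VoisinHodgeI2002, §6.3.2 Thm. 6.32] -/
theorem sigPos_sigNeg_hrFormPQ_of_pos_of_fst_eq_zero_or_snd_eq_zero {g n k p q : ℕ} (e : Fin (2 * g) ≃ ι)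
    (hnk : n + k = g) (hpq : p + q = k) (h0 : p = 0 ∨ q = 0) (h2 : 2 * n + (k + k) = 2 * g)
    {s : Fin n → E [⋀^Fin 2]→L[ℝ] ℝ} (hs : s ∈ positiveTuples E n) :
    sigPos (hrFormPQ Φ e (hrSign k p q) (wedgeFamily n fun j ↦ ofRealForm (-(s j))) h2 p q).toQuadraticMap =
        2 * (g.choose p * g.choose q) ∧
      sigNeg (hrFormPQ Φ e (hrSign k p q) (wedgeFamily n fun j ↦ ofRealForm (-(s j))) h2 p q).toQuadraticMap = 0 := by
  haveI := finiteDimensional_complex Φ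
  haveI : FiniteDimensional ℝ (E [⋀^Fin k]→L[ℝ] ℂ) := finiteDimensional_real_complexForms
  have hg : finrank ℂ E = g := finrank_eq_of_finTwoMulEquiv Φ e
  obtain ⟨t, ht, rfl⟩ := exists_mem_positiveTuples_castSucc_eq Φ hs
  subst hnk
  have hpd := posDef_hrFormPQ_of_pos_of_fst_eq_zero_or_snd_eq_zero Φ e hg hpq h0 h2 ht
  exact ⟨(sigPos_eq_finrank_of_posDef hpd).trans (finrank_typeSubmodule_real hg hpq), sigNeg_eq_zero_of_posDef' hpd⟩

/-- **The recursion along the mixed Lefschetz decomposition** (Dinh–Nguyên Prop. 2.1 (b) + (c)): for a positive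
background `θ_0, …, θ_n` on the torus `X` of dimension `g = n + p + q + 2` and `ω = θ_n`,
`b⁺(h^{(p+1,q+1)}_{(θ_0,…,θ_{n-1})}) = 2 (C(g,p+1) C(g,q+1) - C(g,p) C(g,q)) + b⁻(h^{(p,q)}_{(θ_0,…,θ_n,θ_n)})` and
`b⁻(h^{(p+1,q+1)}_{(θ_0,…,θ_{n-1})}) = b⁺(h^{(p,q)}_{(θ_0,…,θ_n,θ_n)})`: the decomposition
`Λ^{p+1,q+1} = P ⊕ ω ∧ Λ^{p,q}` is `h`-orthogonal, `h` is POSITIVE DEFINITE on `P` (Timorin / Prop. 2.1 (b)) with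
`dim_ℝ P = 2 (C(g,p+1) C(g,q+1) - C(g,p) C(g,q))`, and `C ↦ C ∧ ω` is an isometry from `h^{(p,q)}_{(θ,ω,ω)}` with the
OPPOSITE sign (`ε(k+2, p+1, q+1) = -ε(k, p, q)`) onto `h|_{ω ∧ Λ^{p,q}}` — the alternation of signs along the Lefschetz
decomposition of the classical Hodge index theorem. [cite: DinhNguyen2006, §2 Prop. 2.1 (b), (c) (arXiv PDF p. 5)]
[cite: VoisinHodgeI2002, §6.3.2 Thm. 6.32 and proof of Thm. 6.33] [cite: Cattani2008MixedLefschetz, Thm. 2.2]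
[cite: Gregory1980QuadraticForms, Ch. 2 §2.2 Thm. 12 (chunk p0077)] -/
theorem sigPos_sigNeg_hrFormPQ_succ_succ_of_pos {g n m p q : ℕ} (e : Fin (2 * g) ≃ ι) (hpq : p + q = m)
    (hnk : n + (m + 2) = g) (h2 : 2 * n + ((m + 2) + (m + 2)) = 2 * g) (h2' : 2 * (n + 2) + (m + m) = 2 * g)
    {t : Fin (n + 1) → E [⋀^Fin 2]→L[ℝ] ℝ} (ht : t ∈ positiveTuples E (n + 1)) :
    sigPos (hrFormPQ Φ e (hrSign (m + 2) (p + 1) (q + 1)) (wedgeFamily n (Fin.init fun j ↦ ofRealForm (-(t j)))) h2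
        (p + 1) (q + 1)).toQuadraticMap =
      2 * (g.choose (p + 1) * g.choose (q + 1) - g.choose p * g.choose q) +
        sigNeg (hrFormPQ Φ e (hrSign m p q) (wedgeFamily (n + 2) fun j ↦ ofRealForm
          (-(Fin.snoc (α := fun _ ↦ E [⋀^Fin 2]→L[ℝ] ℝ) t (t (Fin.last n)) j))) h2' p q).toQuadraticMap ∧
    sigNeg (hrFormPQ Φ e (hrSign (m + 2) (p + 1) (q + 1)) (wedgeFamily n (Fin.init fun j ↦ ofRealForm (-(t j)))) h2
        (p + 1) (q + 1)).toQuadraticMap =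
      sigPos (hrFormPQ Φ e (hrSign m p q) (wedgeFamily (n + 2) fun j ↦ ofRealForm
          (-(Fin.snoc (α := fun _ ↦ E [⋀^Fin 2]→L[ℝ] ℝ) t (t (Fin.last n)) j))) h2' p q).toQuadraticMap := by
  haveI := finiteDimensional_complex Φ
  haveI : FiniteDimensional ℝ (E [⋀^Fin (m + 2)]→L[ℝ] ℂ) := finiteDimensional_real_complexForms
  subst hnk
  have hg : finrank ℂ E = n + (m + 2) := finrank_eq_of_finTwoMulEquiv Φ e
  have hσ : conj (hrSign (m + 2) (p + 1) (q + 1)) = (-1) ^ (m + 2) * hrSign (m + 2) (p + 1) (q + 1) :=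
    conj_hrSign (by omega)
  have hσ0 := hrSign_ne_zero (m + 2) (p + 1) (q + 1)
  have hΘ : ∀ j, IsOfTypeAt 1 1 ((fun j ↦ ofRealForm (-(t j))) j) := isOfTypeAt_of_mem_positiveTuples ht
  have hΘr : ∀ j, conjForm ((fun j ↦ ofRealForm (-(t j))) j) = (fun j ↦ ofRealForm (-(t j))) j :=
    conjForm_ofRealForm_neg_family t
  have hHL₁ : ∀ A ∈ typeSubmodule E (m + 2) (p + 1) (q + 1),
      (wedgeFamily n (Fin.init fun j ↦ ofRealForm (-(t j)))).wedge A = 0 → A = 0 :=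
    fun _ hA h0 ↦ mixedHardLefschetz_castSucc_of_pos hg (by omega : (p + 1) + (q + 1) = m + 2) rfl ht hA h0
  have hHL₂ : ∀ C ∈ typeSubmodule E m p q,
      (wedgeFamily (n + 2) (Fin.snoc (α := fun _ ↦ E [⋀^Fin 2]→L[ℝ] ℂ) (fun j ↦ ofRealForm (-(t j)))
        (ofRealForm (-(t (Fin.last n)))))).wedge C = 0 → C = 0 :=
    fun _ hC h0 ↦ mixedHardLefschetz_snoc_of_pos hg hpq rfl ht hC h0
  -- (1) the indices split along the `h`-orthogonal mixed Lefschetz decomposition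
  have h1 := sigPos_sigNeg_hrFormPQ_eq_add Φ hg hpq rfl e hσ hσ0 hΘ hΘr h2 hHL₁ hHL₂
  -- (2) the Lefschetz summand is isometric to `h^{(p,q)}` of the background with `ω` repeated (same sign `ε(k+2)`)
  have h3 := sigPos_sigNeg_restrict_lefschetzReal_eq Φ e (hrSign (m + 2) (p + 1) (q + 1)) hpq hΘ (hΘr (Fin.last n))
    h2 h2' hHL₂
  -- (3) the sign flip `ε(k+2, p+1, q+1) = -ε(k, p, q)`
  have h4 : sigPos (hrFormPQ Φ e (hrSign (m + 2) (p + 1) (q + 1)) (wedgeFamily (n + 2)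
      (Fin.snoc (α := fun _ ↦ E [⋀^Fin 2]→L[ℝ] ℂ) (fun j ↦ ofRealForm (-(t j))) (ofRealForm (-(t (Fin.last n))))))
        h2' p q).toQuadraticMap =
      sigNeg (hrFormPQ Φ e (hrSign m p q) (wedgeFamily (n + 2) fun j ↦ ofRealForm
        (-(Fin.snoc (α := fun _ ↦ E [⋀^Fin 2]→L[ℝ] ℝ) t (t (Fin.last n)) j))) h2' p q).toQuadraticMap := by
    rw [hrSign_succ_succ, hrFormPQ_toQuadraticMap_neg_sign, sigPos_neg, ofRealForm_neg_snoc]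
  have h4' : sigNeg (hrFormPQ Φ e (hrSign (m + 2) (p + 1) (q + 1)) (wedgeFamily (n + 2)
      (Fin.snoc (α := fun _ ↦ E [⋀^Fin 2]→L[ℝ] ℂ) (fun j ↦ ofRealForm (-(t j))) (ofRealForm (-(t (Fin.last n))))))
        h2' p q).toQuadraticMap =
      sigPos (hrFormPQ Φ e (hrSign m p q) (wedgeFamily (n + 2) fun j ↦ ofRealForm
        (-(Fin.snoc (α := fun _ ↦ E [⋀^Fin 2]→L[ℝ] ℝ) t (t (Fin.last n)) j))) h2' p q).toQuadraticMap := by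
    rw [hrSign_succ_succ, hrFormPQ_toQuadraticMap_neg_sign, sigNeg_neg, ofRealForm_neg_snoc]
  -- (4) the primitive summand: positive definite of real dimension `2 (C(g,p+1) C(g,q+1) - C(g,p) C(g,q))`
  have hpd := posDef_hrFormPQ_restrict_primitiveReal_of_pos Φ e hg hpq h2 ht
  have hdim := finrank_primitiveReal_succ_succ hg hpq rfl hΘ hHL₂
  refine ⟨?_, ?_⟩
  · rw [h1.1, h3.1, h4, sigPos_eq_finrank_of_posDef hpd, hdim]
  · rw [h1.2, h3.2, h4', sigNeg_eq_zero_of_posDef' hpd, zero_add]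

/-- The recursion with the shorter background written as `(θ_0, …, θ_{n-1}) = (t ∘ castSucc)`.
[cite: DinhNguyen2006, §2 Prop. 2.1 (b), (c) (arXiv PDF p. 5)] [cite: VoisinHodgeI2002, §6.3.2 proof of Thm. 6.33] -/
theorem sigPos_sigNeg_hrFormPQ_succ_succ_of_pos' {g n m p q : ℕ} (e : Fin (2 * g) ≃ ι) (hpq : p + q = m)
    (hnk : n + (m + 2) = g) (h2 : 2 * n + ((m + 2) + (m + 2)) = 2 * g) (h2' : 2 * (n + 2) + (m + m) = 2 * g)
    {t : Fin (n + 1) → E [⋀^Fin 2]→L[ℝ] ℝ} (ht : t ∈ positiveTuples E (n + 1)) :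
    sigPos (hrFormPQ Φ e (hrSign (m + 2) (p + 1) (q + 1)) (wedgeFamily n fun j ↦ ofRealForm (-(t (Fin.castSucc j))))
        h2 (p + 1) (q + 1)).toQuadraticMap =
      2 * (g.choose (p + 1) * g.choose (q + 1) - g.choose p * g.choose q) +
        sigNeg (hrFormPQ Φ e (hrSign m p q) (wedgeFamily (n + 2) fun j ↦ ofRealForm
          (-(Fin.snoc (α := fun _ ↦ E [⋀^Fin 2]→L[ℝ] ℝ) t (t (Fin.last n)) j))) h2' p q).toQuadraticMap ∧
    sigNeg (hrFormPQ Φ e (hrSign (m + 2) (p + 1) (q + 1)) (wedgeFamily n fun j ↦ ofRealForm (-(t (Fin.castSucc j))))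
        h2 (p + 1) (q + 1)).toQuadraticMap =
      sigPos (hrFormPQ Φ e (hrSign m p q) (wedgeFamily (n + 2) fun j ↦ ofRealForm
          (-(Fin.snoc (α := fun _ ↦ E [⋀^Fin 2]→L[ℝ] ℝ) t (t (Fin.last n)) j))) h2' p q).toQuadraticMap :=
  sigPos_sigNeg_hrFormPQ_succ_succ_of_pos Φ e hpq hnk h2 h2' ht

/-- The closed formula, by induction on `min p q`. [cite: DinhNguyen2006, §2 Prop. 2.1 (b), (c) (arXiv PDF p. 5)]
[cite: VoisinHodgeI2002, §6.3.2 Thm. 6.33 (proof)] -/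
private theorem sigPos_sigNeg_hrFormPQ_eq_sum_aux {g : ℕ} (e : Fin (2 * g) ≃ ι) (N : ℕ) :
    ∀ {n k p q : ℕ}, min p q = N → n + k = g → ∀ (hpq : p + q = k) (h2 : 2 * n + (k + k) = 2 * g)
      {s : Fin n → E [⋀^Fin 2]→L[ℝ] ℝ}, s ∈ positiveTuples E n →
    ((sigPos (hrFormPQ Φ e (hrSign k p q) (wedgeFamily n fun j ↦ ofRealForm (-(s j))) h2 p q).toQuadraticMap : ℕ) : ℤ) =
        2 * ∑ j ∈ range (N + 1), (-1) ^ j * ((g.choose (p - j) * g.choose (q - j) : ℕ) : ℤ) ∧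
      ((sigNeg (hrFormPQ Φ e (hrSign k p q) (wedgeFamily n fun j ↦ ofRealForm (-(s j))) h2 p q).toQuadraticMap : ℕ) : ℤ) =
        2 * ∑ j ∈ range N, (-1) ^ j * ((g.choose (p - 1 - j) * g.choose (q - 1 - j) : ℕ) : ℤ) := by
  haveI := finiteDimensional_complex Φ
  have hg : finrank ℂ E = g := finrank_eq_of_finTwoMulEquiv Φ e
  induction N with
  | zero =>
    intro n k p q hN hnk hpq h2 s hs
    have h0 : p = 0 ∨ q = 0 := by omega
    obtain ⟨hP, hM⟩ := sigPos_sigNeg_hrFormPQ_of_pos_of_fst_eq_zero_or_snd_eq_zero Φ e hnk hpq h0 h2 hs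
    rw [hP, hM, zero_add, Finset.sum_range_one, Finset.sum_range_zero, pow_zero, one_mul, Nat.sub_zero, Nat.sub_zero,
      mul_zero]
    exact ⟨by push_cast; ring, by simp⟩
  | succ N ih =>
    intro n k p q hN hnk hpq h2 s hs
    obtain ⟨p', rfl⟩ : ∃ p', p = p' + 1 := Nat.exists_eq_succ_of_ne_zero (by omega)
    obtain ⟨q', rfl⟩ : ∃ q', q = q' + 1 := Nat.exists_eq_succ_of_ne_zero (by omega)
    have hN' : min p' q' = N := by omega
    obtain rfl : k = (p' + q') + 2 := by omega
    obtain ⟨t, ht, rfl⟩ := exists_mem_positiveTuples_castSucc_eq Φ hs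
    have h2' : 2 * (n + 2) + ((p' + q') + (p' + q')) = 2 * g := by omega
    have hrec := sigPos_sigNeg_hrFormPQ_succ_succ_of_pos' Φ e (rfl : p' + q' = p' + q') hnk h2 h2' ht
    have hIH := ih hN' (by omega : (n + 2) + (p' + q') = g) rfl h2' (snoc_mem_positiveTuples ht)
    have hle := choose_mul_choose_le_choose_succ_mul_choose_succ hg (rfl : p' + q' = p' + q') hnk ht
    refine ⟨?_, ?_⟩
    · rw [hrec.1, Nat.cast_add, hIH.2, Finset.sum_range_succ' _ (N + 1), Finset.sum_range_succ' _ N]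
      have hsum : ∑ j ∈ range N, (-1 : ℤ) ^ (j + 1 + 1) *
          (((g.choose (p' + 1 - (j + 1 + 1)) * g.choose (q' + 1 - (j + 1 + 1)) : ℕ) : ℤ)) =
          ∑ j ∈ range N, (-1 : ℤ) ^ j * (((g.choose (p' - 1 - j) * g.choose (q' - 1 - j)) : ℕ) : ℤ) := by
        refine Finset.sum_congr rfl fun j _ ↦ ?_
        rw [show p' + 1 - (j + 1 + 1) = p' - 1 - j by omega, show q' + 1 - (j + 1 + 1) = q' - 1 - j by omega]
        ring
      rw [hsum, show p' + 1 - (0 + 1) = p' by omega, show q' + 1 - (0 + 1) = q' by omega, Nat.sub_zero, Nat.sub_zero]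
      push_cast [Nat.cast_sub hle]
      ring
    · rw [hrec.2, hIH.1]
      simp only [Nat.add_sub_cancel]

/-- **The mixed Hodge index theorem on a complex torus, every bidegree.** For positive real `(1,1)`-forms
`θ_1, …, θ_n` on `X = E/Φ(ℤ^ι)` of dimension `g = n + p + q`, the indices of inertia of the real mixed
Hodge–Riemann form `h(A, B) = Re(ε(k,p,q) ∫_X (-θ_1)_ℂ ∧ ⋯ ∧ (-θ_n)_ℂ ∧ A ∧ B̄)` (`ε(k,p,q) = (-1)^{k(k-1)/2} i^{p-q}`,
`k = p + q`) on `Λ^{p,q}` (a real space of dimension `2 C(g,p) C(g,q)`) are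
`b⁺ = 2 Σ_{0 ≤ j ≤ min(p,q)} (-1)^j C(g,p-j) C(g,q-j)` and `b⁻ = 2 Σ_{0 ≤ j < min(p,q)} (-1)^j C(g,p-1-j) C(g,q-1-j)`,
i.e. `b⁺ = 2 (dim P^{p,q} + dim P^{p-2,q-2} + ⋯)`, `b⁻ = 2 (dim P^{p-1,q-1} + dim P^{p-3,q-3} + ⋯)` with
`dim P^{a,b} = C(g,a) C(g,b) - C(g,a-1) C(g,b-1)`: `h` is definite with alternating signs on the summands of the
iterated mixed Lefschetz decomposition `Λ^{p,q} = P^{p,q} ⊕ ω P^{p-1,q-1} ⊕ ω ω' P^{p-2,q-2} ⊕ ⋯` (Dinh–Nguyên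
Prop. 2.1 (b), (c) for the successive backgrounds), exactly as in the proof of the classical Hodge index theorem.
[cite: DinhNguyen2006, §2 Prop. 2.1 (b), (c) and §1 Theorems A, C (arXiv PDF pp. 3–5)] [cite: VoisinHodgeI2002, §6.3.2 Thm. 6.32, Thm. 6.33 (proof)]
[cite: Timorin1998, Main Theorem and Corollary 2] [cite: Cattani2008MixedLefschetz, Thm. 2.2] -/
theorem sigPos_sigNeg_hrFormPQ_of_pos {g n k p q : ℕ} (e : Fin (2 * g) ≃ ι) (hnk : n + k = g) (hpq : p + q = k)
    (h2 : 2 * n + (k + k) = 2 * g) {s : Fin n → E [⋀^Fin 2]→L[ℝ] ℝ} (hs : s ∈ positiveTuples E n) :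
    ((sigPos (hrFormPQ Φ e (hrSign k p q) (wedgeFamily n fun j ↦ ofRealForm (-(s j))) h2 p q).toQuadraticMap : ℕ) : ℤ) =
        2 * ∑ j ∈ range (min p q + 1), (-1) ^ j * ((g.choose (p - j) * g.choose (q - j) : ℕ) : ℤ) ∧
      ((sigNeg (hrFormPQ Φ e (hrSign k p q) (wedgeFamily n fun j ↦ ofRealForm (-(s j))) h2 p q).toQuadraticMap : ℕ) : ℤ) =
        2 * ∑ j ∈ range (min p q), (-1) ^ j * ((g.choose (p - 1 - j) * g.choose (q - 1 - j) : ℕ) : ℤ) :=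
  sigPos_sigNeg_hrFormPQ_eq_sum_aux Φ e (min p q) rfl hnk hpq h2 hs

/-- `b⁺` alone. [cite: DinhNguyen2006, §2 Prop. 2.1 (b), (c) (arXiv PDF p. 5)] [cite: VoisinHodgeI2002, §6.3.2 Thm. 6.33 (proof)] -/
theorem sigPos_hrFormPQ_of_pos {g n k p q : ℕ} (e : Fin (2 * g) ≃ ι) (hnk : n + k = g) (hpq : p + q = k)
    (h2 : 2 * n + (k + k) = 2 * g) {s : Fin n → E [⋀^Fin 2]→L[ℝ] ℝ} (hs : s ∈ positiveTuples E n) :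
    ((sigPos (hrFormPQ Φ e (hrSign k p q) (wedgeFamily n fun j ↦ ofRealForm (-(s j))) h2 p q).toQuadraticMap : ℕ) : ℤ) =
      2 * ∑ j ∈ range (min p q + 1), (-1) ^ j * ((g.choose (p - j) * g.choose (q - j) : ℕ) : ℤ) :=
  (sigPos_sigNeg_hrFormPQ_of_pos Φ e hnk hpq h2 hs).1

/-- `b⁻` alone. [cite: DinhNguyen2006, §2 Prop. 2.1 (b), (c) (arXiv PDF p. 5)] [cite: VoisinHodgeI2002, §6.3.2 Thm. 6.33 (proof)] -/
theorem sigNeg_hrFormPQ_of_pos {g n k p q : ℕ} (e : Fin (2 * g) ≃ ι) (hnk : n + k = g) (hpq : p + q = k)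
    (h2 : 2 * n + (k + k) = 2 * g) {s : Fin n → E [⋀^Fin 2]→L[ℝ] ℝ} (hs : s ∈ positiveTuples E n) :
    ((sigNeg (hrFormPQ Φ e (hrSign k p q) (wedgeFamily n fun j ↦ ofRealForm (-(s j))) h2 p q).toQuadraticMap : ℕ) : ℤ) =
      2 * ∑ j ∈ range (min p q), (-1) ^ j * ((g.choose (p - 1 - j) * g.choose (q - 1 - j) : ℕ) : ℤ) :=
  (sigPos_sigNeg_hrFormPQ_of_pos Φ e hnk hpq h2 hs).2

/-- **The signature `τ = b⁺ - b⁻` of the mixed Hodge–Riemann form on `Λ^{p,q}`**: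
`τ = 2 C(g,p) C(g,q) + 4 Σ_{0 ≤ j < min(p,q)} (-1)^{j+1} C(g,p-1-j) C(g,q-1-j)`
(`= 2 (C(g,p) C(g,q) - 2 C(g,p-1) C(g,q-1) + 2 C(g,p-2) C(g,q-2) - ⋯)`), for every positive background.
[cite: DinhNguyen2006, §2 Prop. 2.1 (b), (c) (arXiv PDF p. 5)] [cite: VoisinHodgeI2002, §6.3.2 Thm. 6.33] -/
theorem sigPos_sub_sigNeg_hrFormPQ_of_pos {g n k p q : ℕ} (e : Fin (2 * g) ≃ ι) (hnk : n + k = g) (hpq : p + q = k)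
    (h2 : 2 * n + (k + k) = 2 * g) {s : Fin n → E [⋀^Fin 2]→L[ℝ] ℝ} (hs : s ∈ positiveTuples E n) :
    ((sigPos (hrFormPQ Φ e (hrSign k p q) (wedgeFamily n fun j ↦ ofRealForm (-(s j))) h2 p q).toQuadraticMap : ℕ) : ℤ) -
        sigNeg (hrFormPQ Φ e (hrSign k p q) (wedgeFamily n fun j ↦ ofRealForm (-(s j))) h2 p q).toQuadraticMap =
      2 * (g.choose p * g.choose q : ℕ) +
        4 * ∑ j ∈ range (min p q), (-1) ^ (j + 1) * ((g.choose (p - 1 - j) * g.choose (q - 1 - j) : ℕ) : ℤ) := by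
  obtain ⟨hP, hM⟩ := sigPos_sigNeg_hrFormPQ_of_pos Φ e hnk hpq h2 hs
  rw [hP, hM, Finset.sum_range_succ', pow_zero, one_mul, Nat.sub_zero, Nat.sub_zero]
  have h1 : ∑ j ∈ range (min p q), (-1 : ℤ) ^ (j + 1) * (((g.choose (p - (j + 1)) * g.choose (q - (j + 1))) : ℕ) : ℤ) =
      ∑ j ∈ range (min p q), (-1 : ℤ) ^ (j + 1) * (((g.choose (p - 1 - j) * g.choose (q - 1 - j)) : ℕ) : ℤ) := by
    refine Finset.sum_congr rfl fun j _ ↦ ?_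
    rw [show p - (j + 1) = p - 1 - j by omega, show q - (j + 1) = q - 1 - j by omega]
  have h3 : ∑ j ∈ range (min p q), (-1 : ℤ) ^ j * (((g.choose (p - 1 - j) * g.choose (q - 1 - j)) : ℕ) : ℤ) =
      -∑ j ∈ range (min p q), (-1 : ℤ) ^ (j + 1) * (((g.choose (p - 1 - j) * g.choose (q - 1 - j)) : ℕ) : ℤ) := by
    rw [← Finset.sum_neg_distrib]
    refine Finset.sum_congr rfl fun j _ ↦ ?_
    ring
  rw [h1, h3]
  ring

/-- **All four numbers in one place**: `b⁺ + b⁻ = 2 C(g,p) C(g,q)` (no radical) together with the closed formulae —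
in particular both indices are EVEN (the form is the real part of a Hermitian form).
[cite: DinhNguyen2006, §2 Prop. 2.1 (a)–(c) (arXiv PDF p. 5)] [cite: Gregory1980QuadraticForms, Ch. 2 §2.2 Thm. 14 (chunk p0078)] -/
theorem even_sigPos_and_even_sigNeg_hrFormPQ_of_pos {g n k p q : ℕ} (e : Fin (2 * g) ≃ ι) (hnk : n + k = g)
    (hpq : p + q = k) (h2 : 2 * n + (k + k) = 2 * g) {s : Fin n → E [⋀^Fin 2]→L[ℝ] ℝ}
    (hs : s ∈ positiveTuples E n) :
    Even (sigPos (hrFormPQ Φ e (hrSign k p q) (wedgeFamily n fun j ↦ ofRealForm (-(s j))) h2 p q).toQuadraticMap) ∧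
      Even (sigNeg (hrFormPQ Φ e (hrSign k p q) (wedgeFamily n fun j ↦ ofRealForm (-(s j))) h2 p q).toQuadraticMap) := by
  obtain ⟨hP, hM⟩ := sigPos_sigNeg_hrFormPQ_of_pos Φ e hnk hpq h2 hs
  refine ⟨(Int.even_coe_nat _).1 ⟨_, by rw [hP]; ring⟩, (Int.even_coe_nat _).1 ⟨_, by rw [hM]; ring⟩⟩

/-- **Degree two, bidegree `(1,1)`**: `(b⁺, b⁻) = (2 (g² - 1), 2)` for `h = Re(-∫_X Ω ∧ A ∧ B̄)` on `Λ^{1,1}`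
(`ε(2,1,1) = -1`), torus of dimension `g = n + 2` — the mixed Hodge index theorem on `H^{1,1}` (signature
`(g² - 1, 1)` of the Hermitian form; cf. the tree's `ComplexTorusMixedHodgeIndexDegreeTwo` on the real forms `H²(X, ℝ)`).
[cite: DinhNguyen2006, §1 Thm. 1.2 (Gromov) and §2 Prop. 2.1 (arXiv PDF pp. 3, 5)] [cite: VoisinHodgeI2002, §6.3.2 Thm. 6.33] -/
theorem sigPos_sigNeg_hrFormPQ_oneOne_of_pos {g n : ℕ} (e : Fin (2 * g) ≃ ι) (hn : n + 2 = g)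
    (h2 : 2 * n + (2 + 2) = 2 * g) {s : Fin n → E [⋀^Fin 2]→L[ℝ] ℝ} (hs : s ∈ positiveTuples E n) :
    sigPos (hrFormPQ Φ e (hrSign 2 1 1) (wedgeFamily n fun j ↦ ofRealForm (-(s j))) h2 1 1).toQuadraticMap =
        2 * (g * g - 1) ∧
      sigNeg (hrFormPQ Φ e (hrSign 2 1 1) (wedgeFamily n fun j ↦ ofRealForm (-(s j))) h2 1 1).toQuadraticMap = 2 := by
  obtain ⟨t, ht, rfl⟩ := exists_mem_positiveTuples_castSucc_eq Φ hs
  have h2' : 2 * (n + 2) + (0 + 0) = 2 * g := by omega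
  have hrec := sigPos_sigNeg_hrFormPQ_succ_succ_of_pos' Φ e (rfl : 0 + 0 = 0) hn h2 h2' ht
  obtain ⟨hP, hM⟩ := sigPos_sigNeg_hrFormPQ_of_pos_of_fst_eq_zero_or_snd_eq_zero Φ e (by omega : (n + 2) + 0 = g)
    (rfl : 0 + 0 = 0) (Or.inl rfl) h2' (snoc_mem_positiveTuples ht)
  refine ⟨?_, ?_⟩
  · rw [hrec.1, hM, add_zero, Nat.choose_one_right, Nat.choose_zero_right, mul_one]
  · rw [hrec.2, hP, Nat.choose_zero_right, mul_one]

/-- **The classical point of view: the EMPTY background, middle degree `p + q = g`.** On a complex torus of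
dimension `g` the Hermitian form `H(A, B) = ε(g,p,q) ∫_X A ∧ B̄` on `H^{p,q}(X) = Λ^{p,q}`, `p + q = g`, has
(real) indices of inertia `b⁺ = 2 Σ_{j ≤ min(p,q)} (-1)^j C(g,p-j) C(g,q-j)`,
`b⁻ = 2 Σ_{j < min(p,q)} (-1)^j C(g,p-1-j) C(g,q-1-j)` — the count behind the Hodge index theorem
`τ(X) = Σ (-1)^a h^{a,b}` (Voisin's Thm. 6.33), bidegree by bidegree. [cite: VoisinHodgeI2002, §6.3.2 Thm. 6.32, Thm. 6.33]
[cite: DinhNguyen2006, §1 Thm. 1.1 and §2 Prop. 2.1 (arXiv PDF pp. 3, 5)] -/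
theorem sigPos_sigNeg_hrFormPQ_middle {g p q : ℕ} (e : Fin (2 * g) ≃ ι) (hpq : p + q = g) (h2 : 2 * 0 + (g + g) = 2 * g)
    (s : Fin 0 → E [⋀^Fin 2]→L[ℝ] ℝ) :
    ((sigPos (hrFormPQ Φ e (hrSign g p q) (wedgeFamily 0 fun j ↦ ofRealForm (-(s j))) h2 p q).toQuadraticMap : ℕ) : ℤ) =
        2 * ∑ j ∈ range (min p q + 1), (-1) ^ j * ((g.choose (p - j) * g.choose (q - j) : ℕ) : ℤ) ∧
      ((sigNeg (hrFormPQ Φ e (hrSign g p q) (wedgeFamily 0 fun j ↦ ofRealForm (-(s j))) h2 p q).toQuadraticMap : ℕ) : ℤ) =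
        2 * ∑ j ∈ range (min p q), (-1) ^ j * ((g.choose (p - 1 - j) * g.choose (q - 1 - j) : ℕ) : ℤ) :=
  sigPos_sigNeg_hrFormPQ_of_pos Φ e (zero_add g) hpq h2 (s := s) fun j ↦ j.elim0

end Signature

/-! ## §5 Semi-positive backgrounds (the closure of the cone): the indices can only drop -/

section Semipositive

variable {ι : Type*} [Fintype ι] [DecidableEq ι] {E : Type u} [NormedAddCommGroup E] [NormedSpace ℂ E]
  (Φ : (ι → ℝ) ≃L[ℝ] E)

omit [Fintype ι] [DecidableEq ι] in
/-- A semi-positive tuple plus `c` times a positive form (`c > 0`) is a positive tuple: the semi-positive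
`J`-invariant tuples lie in the closure of the cone of positive backgrounds.
[cite: DinhNguyen2006, §4 (the closure `K̄` of the cone of positive classes; arXiv PDF p. 9)] -/
theorem add_smul_const_mem_positiveTuples {n : ℕ} {s : Fin n → E [⋀^Fin 2]→L[ℝ] ℝ}
    (h11 : ∀ j (x y : E), s j ![I • x, I • y] = s j ![x, y]) (hpsd : ∀ j (v : E), 0 ≤ s j ![I • v, v])
    {η : E [⋀^Fin 2]→L[ℝ] ℝ} (hη11 : ∀ x y : E, η ![I • x, I • y] = η ![x, y])
    (hηpos : ∀ v : E, v ≠ 0 → 0 < η ![I • v, v]) {c : ℝ} (hc : 0 < c) :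
    s + c • (fun _ : Fin n ↦ η) ∈ positiveTuples E n := by
  intro j
  refine ⟨fun x y ↦ ?_, fun v hv ↦ ?_⟩
  · simp only [Pi.add_apply, Pi.smul_apply, ContinuousAlternatingMap.add_apply, ContinuousAlternatingMap.smul_apply,
      h11, hη11]
  · simp only [Pi.add_apply, Pi.smul_apply, ContinuousAlternatingMap.add_apply, ContinuousAlternatingMap.smul_apply,
      smul_eq_mul]
    exact add_pos_of_nonneg_of_pos (hpsd j v) (mul_pos hc (hηpos v hv))

/-- **In the closure of the cone the indices of inertia can only drop**: for a SEMI-positive background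
`θ = (θ_1, …, θ_n)` (`θ_j(i·, i·) = θ_j`, `θ_j(iv, v) ≥ 0`) and any positive background `θ'` of the same length,
`b^±(h_θ) ≤ b^±(h_{θ'})` on `Λ^{p,q}`: the indices are lower semicontinuous in the background (T1, Gregory's
Thm. 5), `θ + c η → θ` as `c → 0⁺` through positive backgrounds, and the indices are constant on the positive cone
(§4) — "by continuity, `Q` is positive semi-definite" on the boundary of the Hodge–Riemann cone (Dinh–Nguyên §4).
[cite: DinhNguyen2006, §4 Prop. 4.1 (proof) (arXiv PDF p. 9)] [cite: Gregory1980QuadraticForms, Ch. 2 §2.3 Thm. 5 (chunk p0086)]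
[cite: Timorin1998, Main Theorem] -/
theorem sigPos_sigNeg_hrFormPQ_le_of_semipos {g n k p q : ℕ} (e : Fin (2 * g) ≃ ι) (hnk : n + k = g)
    (hpq : p + q = k) (h2 : 2 * n + (k + k) = 2 * g) {s t : Fin n → E [⋀^Fin 2]→L[ℝ] ℝ}
    (h11 : ∀ j (x y : E), s j ![I • x, I • y] = s j ![x, y]) (hpsd : ∀ j (v : E), 0 ≤ s j ![I • v, v])
    (ht : t ∈ positiveTuples E n) :
    sigPos (hrFormPQ Φ e (hrSign k p q) (wedgeFamily n fun j ↦ ofRealForm (-(s j))) h2 p q).toQuadraticMap ≤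
        sigPos (hrFormPQ Φ e (hrSign k p q) (wedgeFamily n fun j ↦ ofRealForm (-(t j))) h2 p q).toQuadraticMap ∧
      sigNeg (hrFormPQ Φ e (hrSign k p q) (wedgeFamily n fun j ↦ ofRealForm (-(s j))) h2 p q).toQuadraticMap ≤
        sigNeg (hrFormPQ Φ e (hrSign k p q) (wedgeFamily n fun j ↦ ofRealForm (-(t j))) h2 p q).toQuadraticMap := by
  haveI := finiteDimensional_complex Φ
  haveI : FiniteDimensional ℝ (E [⋀^Fin k]→L[ℝ] ℂ) := finiteDimensional_real_complexForms
  obtain ⟨η, hη11, hηpos⟩ := exists_pos_typeOneOne Φ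
  -- the family of forms over all backgrounds is continuous
  set B : (Fin n → E [⋀^Fin 2]→L[ℝ] ℝ) → LinearMap.BilinForm ℝ ↥((typeSubmodule E k p q).restrictScalars ℝ) :=
    fun r ↦ hrFormPQ Φ e (hrSign k p q) (wedgeFamily n fun j ↦ ofRealForm (-(r j))) h2 p q with hB
  have hcont : ∀ x y : ↥((typeSubmodule E k p q).restrictScalars ℝ), Continuous fun r ↦ B r x y := by
    intro x y
    have h := continuous_hrForm_wedgeFamily Φ e (hrSign k p q) h2 (θ := fun (r : Fin n → E [⋀^Fin 2]→L[ℝ] ℝ) j ↦ r j)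
      (fun j ↦ continuous_apply j) (x : E [⋀^Fin k]→L[ℝ] ℂ) (y : E [⋀^Fin k]→L[ℝ] ℂ)
    simp only [hrForm_apply] at h
    simp only [hB, hrFormPQ_apply]
    exact h
  -- the path `c ↦ θ + c η` tends to `θ` as `c → 0⁺`
  have hpath : Filter.Tendsto (fun c : ℝ ↦ s + c • (fun _ : Fin n ↦ η)) (nhdsWithin 0 (Set.Ioi 0)) (nhds s) := by
    have hc : Continuous (fun c : ℝ ↦ s + c • (fun _ : Fin n ↦ η)) :=
      continuous_const.add (continuous_id.smul continuous_const)
    have h0 := hc.tendsto 0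
    rw [zero_smul, add_zero] at h0
    exact h0.mono_left nhdsWithin_le_nhds
  have hev₁ := hpath.eventually (eventually_sigPos_le B hcont s)
  have hev₂ := hpath.eventually (eventually_sigNeg_le B hcont s)
  have hev₃ : ∀ᶠ c in nhdsWithin (0 : ℝ) (Set.Ioi 0), c ∈ Set.Ioi (0 : ℝ) := eventually_mem_nhdsWithin
  obtain ⟨c, ⟨h₁, h₂⟩, hc⟩ := ((hev₁.and hev₂).and hev₃).exists
  have hmem := add_smul_const_mem_positiveTuples h11 hpsd hη11 hηpos (Set.mem_Ioi.1 hc)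
  have heq := sigPos_sigNeg_hrFormPQ_eq_of_pos Φ e hnk hpq h2 hmem ht
  exact ⟨h₁.trans_eq heq.1, h₂.trans_eq heq.2⟩

/-- **Upper bounds in the closure of the cone, closed form**: for a semi-positive background on `Λ^{p,q}`,
`b⁺ ≤ 2 Σ_{j ≤ min(p,q)} (-1)^j C(g,p-j) C(g,q-j)` and `b⁻ ≤ 2 Σ_{j < min(p,q)} (-1)^j C(g,p-1-j) C(g,q-1-j)` (with
equality iff the form is non-degenerate, since `b⁺ + b⁻ + dim rad = 2 C(g,p) C(g,q)`).
[cite: DinhNguyen2006, §4 Prop. 4.1 (arXiv PDF p. 9)] [cite: Gregory1980QuadraticForms, Ch. 2 §2.3 Thm. 5 / Thm. 6 (5) (chunks p0086–p0087)] -/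
theorem sigPos_sigNeg_hrFormPQ_le_sum_of_semipos {g n k p q : ℕ} (e : Fin (2 * g) ≃ ι) (hnk : n + k = g)
    (hpq : p + q = k) (h2 : 2 * n + (k + k) = 2 * g) {s : Fin n → E [⋀^Fin 2]→L[ℝ] ℝ}
    (h11 : ∀ j (x y : E), s j ![I • x, I • y] = s j ![x, y]) (hpsd : ∀ j (v : E), 0 ≤ s j ![I • v, v]) :
    ((sigPos (hrFormPQ Φ e (hrSign k p q) (wedgeFamily n fun j ↦ ofRealForm (-(s j))) h2 p q).toQuadraticMap : ℕ) : ℤ) ≤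
        2 * ∑ j ∈ range (min p q + 1), (-1) ^ j * ((g.choose (p - j) * g.choose (q - j) : ℕ) : ℤ) ∧
      ((sigNeg (hrFormPQ Φ e (hrSign k p q) (wedgeFamily n fun j ↦ ofRealForm (-(s j))) h2 p q).toQuadraticMap : ℕ) : ℤ) ≤
        2 * ∑ j ∈ range (min p q), (-1) ^ j * ((g.choose (p - 1 - j) * g.choose (q - 1 - j) : ℕ) : ℤ) := by
  obtain ⟨t, ht⟩ := positiveTuples_nonempty Φ (E := E) n
  obtain ⟨hP, hM⟩ := sigPos_sigNeg_hrFormPQ_of_pos Φ e hnk hpq h2 ht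
  obtain ⟨h₁, h₂⟩ := sigPos_sigNeg_hrFormPQ_le_of_semipos Φ e hnk hpq h2 h11 hpsd ht
  exact ⟨(Int.ofNat_le.2 h₁).trans_eq hP, (Int.ofNat_le.2 h₂).trans_eq hM⟩

/-- **Radical count in the closure of the cone**: for a semi-positive background,
`dim (radical of h on Λ^{p,q}) = 2 C(g,p) C(g,q) - b⁺ - b⁻ ≥ 0`, and `h` is non-degenerate on `Λ^{p,q}` iff
`(b⁺, b⁻)` equals the value on the open cone (Dinh–Nguyên's "`K^{HR}` is a union of connected components of
`K ∖ L`": non-degeneracy ⟺ the Hodge–Riemann count). [cite: DinhNguyen2006, §4 Prop. 4.1 (arXiv PDF p. 9)]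
[cite: Gregory1980QuadraticForms, Ch. 2 §2.3 Thm. 6 (5) and Cor. 7 (chunk p0087)] -/
theorem radical_hrFormPQ_eq_bot_iff_of_semipos {g n k p q : ℕ} (e : Fin (2 * g) ≃ ι) (hnk : n + k = g)
    (hpq : p + q = k) (h2 : 2 * n + (k + k) = 2 * g) {s t : Fin n → E [⋀^Fin 2]→L[ℝ] ℝ}
    (h11 : ∀ j (x y : E), s j ![I • x, I • y] = s j ![x, y]) (hpsd : ∀ j (v : E), 0 ≤ s j ![I • v, v])
    (ht : t ∈ positiveTuples E n) :
    (hrFormPQ Φ e (hrSign k p q) (wedgeFamily n fun j ↦ ofRealForm (-(s j))) h2 p q).toQuadraticMap.radical = ⊥ ↔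
      sigPos (hrFormPQ Φ e (hrSign k p q) (wedgeFamily n fun j ↦ ofRealForm (-(s j))) h2 p q).toQuadraticMap =
          sigPos (hrFormPQ Φ e (hrSign k p q) (wedgeFamily n fun j ↦ ofRealForm (-(t j))) h2 p q).toQuadraticMap ∧
        sigNeg (hrFormPQ Φ e (hrSign k p q) (wedgeFamily n fun j ↦ ofRealForm (-(s j))) h2 p q).toQuadraticMap =
          sigNeg (hrFormPQ Φ e (hrSign k p q) (wedgeFamily n fun j ↦ ofRealForm (-(t j))) h2 p q).toQuadraticMap := by
  haveI := finiteDimensional_complex Φ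
  haveI : FiniteDimensional ℝ (E [⋀^Fin k]→L[ℝ] ℂ) := finiteDimensional_real_complexForms
  have hg : finrank ℂ E = g := finrank_eq_of_finTwoMulEquiv Φ e
  obtain ⟨h₁, h₂⟩ := sigPos_sigNeg_hrFormPQ_le_of_semipos Φ e hnk hpq h2 h11 hpsd ht
  have ht' := sigPos_add_sigNeg_hrFormPQ_of_pos Φ e hnk hpq h2 ht
  have hs' := QuadraticForm.sigPos_add_sigNeg_add_radical
    (Q := (hrFormPQ Φ e (hrSign k p q) (wedgeFamily n fun j ↦ ofRealForm (-(s j))) h2 p q).toQuadraticMap)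
  rw [finrank_typeSubmodule_real hg hpq] at hs'
  constructor
  · intro hrad
    rw [hrad, finrank_bot, add_zero] at hs'
    omega
  · rintro ⟨hP, hM⟩
    rw [hP, hM] at hs'
    exact Submodule.finrank_eq_zero.1 (by omega)

end Semipositive

end ComplexTorus

end Literature.Geometry.Kaehler

end
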